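import Mathlib
import HarnessLib
import Summits.ResolutionOfSingularities.ResolutionOfSingularities.Theorems.WildQuotientsWildQuotientResolutionS1aTriangularShiftKillsIn

/-!
# S1a — THE FIRST PARAMETRIC ONE-SHOT FAMILY: the tail `x₁^d` (a1d_d) is killed by ONE move with centre (x₀ : d+1, x₁ : 1) and shift δ = d, every `d ≥ 1`, every `p`

[OURS · L1 W4.5c · lead-1 g14; plan-1 RULING R-F15j (2) «add, if cheap, the first PARAMETRIC corollary `a1d_killsIn_one` (tail x₁^d, every d ≥ 1 …)» — census 13s-e
(kit j326873): engine depth = d exactly for a1d_d, the engine simulating the weighted root kill by unit steps (caveat E-W)] — NOT statements of the manuscript; counted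
0; AI-level work, weaker than expert review. Crux stmt-ResolutionOfSingularities-17941 `CyclicQuotientFourfolds`, line `s1a-logminvertex` v13 (`stub_reachLowerInFX`).

Datum a1d_d: σ: x₀ fixed, x₁ ↦ x₁ + x₀, x₂ ↦ x₂ + x₀, x₃ ↦ x₃ + x₁^d (`d ≥ 1`; order-p hypothesis instantiable for `p > d + 1`). The weights announced in R-F15j
«(x₀:d, x₁:1)» are corrected to (x₀ : d+1, x₁ : 1): the row `σx₁ − x₁ = x₀` must lie in `𝒥_{w(x₁)+δ} = 𝒥_{1+d}`. Power chains: `x₀ = σx₁ − x₁` (m = 1, u = x₁ ∈ 𝒥₁ =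
𝒥_{(d+1)−d}`), `x₁^d = σx₃ − x₃` (m = d, u = x₃ ∈ 𝒥₀); (a′)_d on generators: `x₀ ∈ 𝒥_d` (rows of x₁, x₂), `x₁^d ∈ 𝒥_d`; isolation `(x₀, x₁)^N ≤ I_σ = (x₀, x₁^d)`.
* ★ `a1d_killsIn_one` — `KillsIn 1 (GModel.initial hq h₀)` for every `d ≥ 1` and every `p`; `exists_reachLowerF_initial_of_a1d`.
-/

set_option linter.dupNamespace false

noncomputable section

open CategoryTheory Limits AlgebraicGeometry TopologicalSpace Topology Opposite MvPolynomial
open Literature.AlgebraicGeometry.Resolution Literature.AlgebraicGeometry.RelativeSpec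
open Summit.ResolutionOfSingularities.ResolutionOfSingularities.Theorems.WildQuotientResolution.S1
open Summit.ResolutionOfSingularities.ResolutionOfSingularities.Theorems.WildQuotientResolution.S1.NodeAtlas
open Summit.ResolutionOfSingularities.ResolutionOfSingularities.Theorems.WildQuotientResolution.S1.KillCert
open Summit.ResolutionOfSingularities.ResolutionOfSingularities.Theorems.WildQuotientResolution.S1.GoodCharts
open Summit.ResolutionOfSingularities.ResolutionOfSingularities.Theorems.WildQuotientResolution.S1.NpFrame

namespace Summit.ResolutionOfSingularities.ResolutionOfSingularities.Theorems.WildQuotientResolution.S1.GameFrame.GModel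

open KillCert

variable {p : ℕ} {X' X₁ : Scheme.{0}} {q : X' ⟶ X₁} {G : Type} [Group G] {ρ : G →* Aut X'} {g₀ : G}

/-- ★ **a1d_d is a one-shot kill for every `d ≥ 1`** (σ: x₁ ↦ x₁+x₀, x₂ ↦ x₂+x₀, x₃ ↦ x₃+x₁^d): centre (x₀ : d+1, x₁ : 1), shift `δ = d`, power chains
`x₀ = σx₁ − x₁`, `x₁^d = σx₃ − x₃`. [OURS · L1 W4.5c · R-F15j (2); NOT a statement of the manuscript] -/
theorem a1d_killsIn_one [Finite G] (hp : p.Prime) (hG : ∀ g : G, g ∈ Subgroup.zpowers g₀) (hg₀ : g₀ ^ p = 1)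
    (hq : ∀ g : G, (ρ g).hom ≫ q = q) [IsIntegral X'] [IsLocallyNoetherian X'] [X'.IsSeparated] [IsAffine X'] [X₁.IsSeparated] [IsFinite q]
    (hreg : Scheme.IsRegular X') {k' : Type} [Field k'] (φ : X₁ ⟶ Spec (.of k')) [LocallyOfFiniteType φ]
    {k : Type} [Field k] (σ : MvPolynomial (Fin 4) k ≃+* MvPolynomial (Fin 4) k) (hC : ∀ a : k, σ (C a) = C a)
    (d : ℕ) (hd : 1 ≤ d)
    (h0 : σ (X 0) = X 0) (h1 : σ (X 1) = X 1 + X 0) (h2 : σ (X 2) = X 2 + X 0) (h3 : σ (X 3) = X 3 + X 1 ^ d)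
    (e : Γ(X', ⊤) ≃+* MvPolynomial (Fin 4) k)
    (hστ : ∀ t : Γ(X', ⊤), e ((ρ g₀⁻¹).hom.appLE ⊤ ⊤ (by rw [Scheme.Hom.preimage_top]) t) = σ (e t))
    (h₀ : NodeAtlas p (⟨ρ, hq⟩ : ActionOver q G) g₀) :
    KillsIn 1 (GModel.initial (p := p) (g₀ := g₀) hq h₀) := by
  let v : Fin 2 → Fin 4 := ![0, 1]
  let w : Fin 2 → ℕ := ![d + 1, 1]
  have hv : Function.Injective v := by decide
  have hw0 : w 0 = d + 1 := rfl
  have hw1 : w 1 = 1 := rfl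
  have hX0 : (X 0 : MvPolynomial (Fin 4) k) ∈ (weightedFiltration (X ∘ v : Fin 2 → MvPolynomial (Fin 4) k) w).ideal (d + 1) :=
    mem_weightedFiltration_ideal (X ∘ v : Fin 2 → MvPolynomial (Fin 4) k) w 0
  have hX1 : (X 1 : MvPolynomial (Fin 4) k) ∈ (weightedFiltration (X ∘ v : Fin 2 → MvPolynomial (Fin 4) k) w).ideal 1 :=
    mem_weightedFiltration_ideal (X ∘ v : Fin 2 → MvPolynomial (Fin 4) k) w 1
  have hX1d : (X 1 : MvPolynomial (Fin 4) k) ^ d ∈ (weightedFiltration (X ∘ v : Fin 2 → MvPolynomial (Fin 4) k) w).ideal d := by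
    have h := pow_mem_weightedFiltration_ideal (X ∘ v : Fin 2 → MvPolynomial (Fin 4) k) w 1 d
    rwa [hw1, mul_one] at h
  have hinc0 : σ (X 0) - X 0 = 0 := by rw [h0, sub_self]
  have hinc1 : σ (X 1) - X 1 = X 0 := by rw [h1]; ring
  have hinc2 : σ (X 2) - X 2 = X 0 := by rw [h2]; ring
  have hinc3 : σ (X 3) - X 3 = X 1 ^ d := by rw [h3]; ring
  refine triangularShift_killsIn_one hp hG hg₀ hq hreg φ σ hC (by norm_num : 0 < 2) v hv w
    (fun l => by fin_cases l <;> simp [w]) d ?_ ?_ ?_ ?_ e hστ h₀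
  · intro i
    fin_cases i
    · change σ (X 0) - X 0 ∈ _; rw [hinc0]; exact Ideal.zero_mem _
    · change σ (X 1) - X 1 ∈ _; rw [hinc1]; exact (weightedFiltration _ w).antitone (Nat.le_succ d) hX0
    · change σ (X 2) - X 2 ∈ _; rw [hinc2]; exact (weightedFiltration _ w).antitone (Nat.le_succ d) hX0
    · change σ (X 3) - X 3 ∈ _; rw [hinc3]; exact hX1d
  · intro l
    fin_cases l
    · change σ (X 0) - X 0 ∈ _; rw [hinc0]; exact Ideal.zero_mem _
    · change σ (X 1) - X 1 ∈ (weightedFiltration (X ∘ v : Fin 2 → MvPolynomial (Fin 4) k) w).ideal (1 + d)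
      rw [hinc1, add_comm]; exact hX0
  · refine exists_span_pow_le_of_pow_mem _ _ fun l => ?_
    fin_cases l
    · refine ⟨1, ?_⟩; change (X 0 : MvPolynomial (Fin 4) k) ^ 1 ∈ _
      rw [pow_one, ← hinc1]; exact sub_mem_augmentationIdeal σ _
    · refine ⟨d, ?_⟩; change (X 1 : MvPolynomial (Fin 4) k) ^ d ∈ _
      rw [← hinc3]; exact sub_mem_augmentationIdeal σ _
  · intro l
    fin_cases l
    · refine ⟨1, X 1, 1, one_pos, ?_, isUnit_one, ?_, ?_⟩
      · change d ≤ 1 * (d + 1); omega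
      · change (X 1 : MvPolynomial (Fin 4) k) ∈ (weightedFiltration (X ∘ v : Fin 2 → MvPolynomial (Fin 4) k) w).ideal (1 * (d + 1) - d)
        have e1 : 1 * (d + 1) - d = 1 := by omega
        rw [e1]; exact hX1
      · change σ (X 1) - X 1 - 1 * X 0 ^ 1 ∈ _
        have e0 : σ (X 1) - X 1 - 1 * X 0 ^ 1 = 0 := by rw [hinc1]; ring
        rw [e0]; exact Ideal.zero_mem _
    · refine ⟨d, X 3, 1, hd, ?_, isUnit_one, ?_, ?_⟩
      · change d ≤ d * 1; omega
      · change (X 3 : MvPolynomial (Fin 4) k) ∈ (weightedFiltration (X ∘ v : Fin 2 → MvPolynomial (Fin 4) k) w).ideal (d * 1 - d)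
        have e1 : d * 1 - d = 0 := by omega
        rw [e1]; exact mem_weightedFiltration_zero _ w _
      · change σ (X 3) - X 3 - 1 * X 1 ^ d ∈ _
        have e0 : σ (X 3) - X 3 - 1 * X 1 ^ d = 0 := by rw [hinc3]; ring
        rw [e0]; exact Ideal.zero_mem _

/-- **a1d_d satisfies the conclusion of `ReachLowerInF(X)`** at its initial model with ANY root decoration, every `d ≥ 1`, every `p`. [OURS · L1 W4.5c · R-F15j (2)] -/
theorem exists_reachLowerF_initial_of_a1d [Finite G] (hp : p.Prime) (hG : ∀ g : G, g ∈ Subgroup.zpowers g₀) (hg₀ : g₀ ^ p = 1)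
    (hq : ∀ g : G, (ρ g).hom ≫ q = q) [IsIntegral X'] [IsLocallyNoetherian X'] [X'.IsSeparated] [IsAffine X'] [X₁.IsSeparated] [IsFinite q]
    (hreg : Scheme.IsRegular X') {k' : Type} [Field k'] (φ : X₁ ⟶ Spec (.of k')) [LocallyOfFiniteType φ]
    {k : Type} [Field k] (σ : MvPolynomial (Fin 4) k ≃+* MvPolynomial (Fin 4) k) (hC : ∀ a : k, σ (C a) = C a)
    (d : ℕ) (hd : 1 ≤ d)
    (h0 : σ (X 0) = X 0) (h1 : σ (X 1) = X 1 + X 0) (h2 : σ (X 2) = X 2 + X 0) (h3 : σ (X 3) = X 3 + X 1 ^ d)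
    (e : Γ(X', ⊤) ≃+* MvPolynomial (Fin 4) k)
    (hστ : ∀ t : Γ(X', ⊤), e ((ρ g₀⁻¹).hom.appLE ⊤ ⊤ (by rw [Scheme.Hom.preimage_top]) t) = σ (e t))
    (h₀ : NodeAtlas p (⟨ρ, hq⟩ : ActionOver q G) g₀) (𝔄₀ : NodeAtlasData p (GModel.initial hq h₀).act g₀) :
    ∃ P : ∀ M : GModel p q G ρ g₀, NodeAtlasData p M.act g₀ → Prop,
      P (GModel.initial hq h₀) 𝔄₀ ∧ ∀ (M : GModel p q G ρ g₀) (𝔄 : NodeAtlasData p M.act g₀), P M 𝔄 → ¬ M.Terminal →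
        ∃ n : ℕ, TreeF P (fun N 𝔅 => LexLTF N 𝔅 M 𝔄) n M 𝔄 :=
  exists_reachLowerF_of_killsIn_datum hp hG φ (GModel.initial hq h₀) 𝔄₀ (a1d_killsIn_one hp hG hg₀ hq hreg φ σ hC d hd h0 h1 h2 h3 e hστ h₀)

end Summit.ResolutionOfSingularities.ResolutionOfSingularities.Theorems.WildQuotientResolution.S1.GameFrame.GModel

end
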